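import Summits.ABC.ABC.Theses.DefiniteXi
import Summits.ABC.ABC.Theorems.DefiniteXiFreyModularity
import Summits.ABC.ABC.Theorems.DefiniteXiDefiniteRTControlPrimeValTransport
import Literature.NumberTheory.EllipticCurves.PastenSpectralDegree
import Literature.NumberTheory.EllipticCurves.PastenHeightBounds
import Literature.NumberTheory.EllipticCurves.PastenHeightBoundsLemma68LocalProofs
import Literature.NumberTheory.EllipticCurves.PastenHeightBoundsLemma68Proofs
import Literature.NumberTheory.EllipticCurves.LatticeInclusionIsogenyDegreeProofs
import Literature.NumberTheory.EllipticCurves.IsogenyDegreeLatticeIndexProofs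
import Literature.NumberTheory.EllipticCurves.ModularCurveManinSemistableBridgeProofs
import Literature.NumberTheory.EllipticCurves.ModularCurveManinSemistableLatticeFormProofs
import Literature.NumberTheory.EllipticCurves.ModularCurveNeronLatticeProofs
import Literature.NumberTheory.EllipticCurves.ModularDegreeMinimal
import Literature.NumberTheory.EllipticCurves.IsogenyVariableChangeProofs
import Literature.NumberTheory.EllipticCurves.IsogenyCompProofs
import Literature.NumberTheory.EllipticCurves.IsogenyDualProofs
import Literature.NumberTheory.EllipticCurves.IsogenyIdProofs
import Literature.NumberTheory.EllipticCurves.RationalIsogenyDegreesProofs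
import Literature.NumberTheory.DiophantineGeometry.MinimalDiscriminantSmulProofs
import Literature.NumberTheory.DiophantineGeometry.MinimalDiscriminantFactorizationProofs
import HarnessLib

/-!
# stub-ideation k3 g5 (FAMILY 3, probe the extremes) — `stub_pastenLemma68` of the line `Sketch`,
# crux `DefiniteXi.DefiniteRTControlPrime` (stmt-ABC-11338)

Companion Lean file of `STUB-IDEAS-stub_pastenLemma68-3.md` (gen 5).  Gen 4 (k3, PLAN Ω) showed that
INSIDE THIS CRUX the stub is not needed: `valTransport_of_pasten163` replaces the single use `hval` of
Lemma 6.8 at the Takahashi pivot.  Gen 5 pushes that extreme ROUTE-WIDE: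

**`L68²` — Pasten's Lemma 6.8 with the constant `163²` in place of `163`, for every modular
`ℚ`-isogeny class, PROVED from `PastenShimura2024_minimalDegree_le_163_mul` alone** (no Mazur–Kenku,
no `PastenShimura2024_lemma_6_8`): every curve `W ~ V` of a class carrying a parametrisation datum
`D_V` is reached from the lattice-optimal curve `W₀` (`exists_optimalDatum'`) by the lattice isogeny
of H1, whose degree is `deg D₁(W_min)/deg D₀ ≤ 163` by the fact (T1 transports the datum to the
global minimal model `C • W`, T2 bounds the degree); along a `ℚ`-isogeny of degree `d` at a
multiplicative place `c_v(W₀) · b = c_v(C • W) · a` with `ab ∣ d` (tree, Tate curve, Mazur-free);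
two such identities give `c_v(W) · n = c_v(W') · m` with `1 ≤ m, n ≤ 163²`.

Consequence (`valTransportSq_of_pasten163[_self]`): the conclusion of the landed
`Theorems/DefiniteXiDefiniteRTControlPrimeValTransport.lean::stub_valTransport` with `163 · 163` for
`163`, from `h163` + any datum of the class — a drop-in for ALL EIGHT call sites of
`stub_valTransport h68 …` in `Theorems/DefiniteXi{DefiniteRTControlPrime, SteinbergCoreXiDegreeComparison,
SteinbergCoreXiDegreeComparisonPrime, XiStrongBoundDegreeCalibration, XiStrongBoundPrimeCalibration}.lean`
(each has a datum `D`/`D₀`/`P` of the class in scope and an existential or `N^ε`-absorbed constant),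
so the hypothesis `h68 : PastenShimura2024_lemma_6_8` — route item `IsogenyValuationTransport`
(stmt-ABC-18928, Mazur–Kenku-complete) — becomes droppable from every consumer, not only from this crux.

H0, H1 are copied VERBATIM from the gen-4 companion `StubIdeasK3G4PastenLemma68.lean` (crux-dir files
are not importable); T1, T2, L68², VT² are new.  `lean check --json`: rc 0, 0 sorries.
-/

set_option linter.dupNamespace false

noncomputable section

namespace Summit.ABC.ABC.Cruxes.DefiniteRTControlPrime.StubIdeas3G5

open Summit.ABC.ABC.Theses.DefiniteXi
open Literature.NumberTheory.EllipticCurves Literature.NumberTheory.EllipticCurves.ModularForms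
open Literature.NumberTheory.Automorphic
open WeierstrassCurve IsDedekindDomain

/-! ## H0, H1 — verbatim from gen 4 (k3 g4 companion), PROVED there and here -/

/-- **H0 (rescaling, verbatim from k3 g4).** If `Λ₀ = c₀ Λ_f` (`c₀ ≠ 0`) then
`#ker(z ↦ (c/c₀) z : ℂ/Λ₀ → ℂ/Λ') = #ker(z ↦ c z : ℂ/Λ_f → ℂ/Λ')`. [folklore] -/
theorem natCard_ker_mulQuotientMap_rescale {Λf Λ₀ Λ' : AddSubgroup ℂ} {c₀ c c' : ℂ}
    (hc₀ : c₀ ≠ 0) (h₀ : ∀ z, z ∈ Λ₀ ↔ ∃ w ∈ Λf, z = c₀ * w) (hcc : c' * c₀ = c)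
    {hc : ∀ z ∈ Λf, c * z ∈ Λ'} {hc' : ∀ z ∈ Λ₀, c' * z ∈ Λ'} :
    Nat.card (mulQuotientMap Λ₀ Λ' c' hc').ker = Nat.card (mulQuotientMap Λf Λ' c hc).ker := by
  have he : ∀ z ∈ Λf, c₀ * z ∈ Λ₀ := fun z hz => (h₀ _).mpr ⟨z, hz, rfl⟩
  set e := mulQuotientMap Λf Λ₀ c₀ he with he_def
  have hsurj : Function.Surjective e := mulQuotientMap_surjective hc₀
  have hinj : Function.Injective e := by
    rw [← AddMonoidHom.ker_eq_bot_iff, eq_bot_iff]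
    intro P hP
    induction P using QuotientAddGroup.induction_on with
    | H z =>
      rw [AddMonoidHom.mem_ker, he_def, mulQuotientMap_mk, QuotientAddGroup.eq_zero_iff] at hP
      obtain ⟨w, hw, hzw⟩ := (h₀ _).mp hP
      have hzw' : z = w := mul_left_cancel₀ hc₀ hzw
      rw [AddSubgroup.mem_bot, QuotientAddGroup.eq_zero_iff, hzw']
      exact hw
  have hcomp : (mulQuotientMap Λ₀ Λ' c' hc').comp e = mulQuotientMap Λf Λ' c hc := by
    refine AddMonoidHom.ext fun P => ?_
    induction P using QuotientAddGroup.induction_on with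
    | H z =>
      rw [AddMonoidHom.comp_apply, he_def, mulQuotientMap_mk, mulQuotientMap_mk, mulQuotientMap_mk,
        ← mul_assoc, hcc]
  have hker_e : Nat.card e.ker = 1 := by
    rw [(AddMonoidHom.ker_eq_bot_iff e).mpr hinj, AddSubgroup.card_bot]
  rw [← hcomp, AddMonoidHom.natCard_ker_comp_of_surjective _ _ hsurj, hker_e, mul_one]

/-- **H1 (optimal isogeny with degree, verbatim from k3 g4).** For the lattice-optimal datum
`(W₀, D₀)` (`Λ_{W₀} = c₀ Λ_f`) and any datum `P` of `W'` with the same newform there is a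
`ℚ`-isogeny `ψ : W₀ → W'` with `deg ψ · deg D₀ = deg P`. [cite: Knapp1993, Prop. 12.9(a) and p. 302]
[cite: SilvermanAEC2009, Thm. VI.4.1(b)] -/
theorem exists_isogeny_degree_mul_modularDegree_eq {N : ℕ} [NeZero N]
    {W₀ W' : WeierstrassCurve ℚ} [W₀.IsElliptic] [W'.IsElliptic]
    (D₀ : ModularParametrizationData W₀ N) (P : ModularParametrizationData W' N)
    (h₀ : ∀ z ∈ D₀.L.lattice, ∃ w ∈ periodLattice D₀.f, z = D₀.c * w) (hf : P.f = D₀.f) :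
    ∃ ψ : Isogeny W₀ W', ψ.degree * D₀.modularDegree = P.modularDegree := by
  have hker₀ : D₀.isogenyMap.ker = ⊥ := D₀.isogenyMap_ker_eq_bot_iff.mpr h₀
  have hinj : Function.Injective D₀.isogenyMap := (AddMonoidHom.ker_eq_bot_iff _).mp hker₀
  obtain ⟨-, hdeg⟩ := P.modularDegree_eq_card_ker_mul hf D₀.smul_periodLattice_le hinj
    D₀.deg_pos D₀.finite_setOf_natCard_fiberOrbits_ne
  have hc₀ : (D₀.c : ℚ) ≠ 0 := by exact_mod_cast D₀.maninConstant_ne_zero_holds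
  have hcP : (P.c : ℚ) ≠ 0 := by exact_mod_cast P.maninConstant_ne_zero_holds
  have hc : (P.c : ℚ) / (D₀.c : ℚ) ≠ 0 := div_ne_zero hcP hc₀
  have hcast : (((P.c : ℚ) / (D₀.c : ℚ) : ℚ) : ℂ) = (P.c : ℂ) / (D₀.c : ℂ) := by
    rw [Rat.cast_div, Rat.cast_intCast, Rat.cast_intCast]
  have hle : ∀ z ∈ D₀.L.lattice, (((P.c : ℚ) / (D₀.c : ℚ) : ℚ) : ℂ) * z ∈ P.L.lattice := by
    intro z hz
    obtain ⟨w, hw, rfl⟩ := h₀ z hz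
    have hw' : w ∈ periodLattice P.f := by rw [hf]; exact hw
    rw [hcast, div_mul_eq_mul_div, mul_left_comm, mul_div_cancel_left₀ _ D₀.cast_c_ne_zero]
    exact P.smul_periodLattice_le w hw'
  obtain ⟨ψ, hψ⟩ := exists_isogeny_degree_eq_of_isNeronLatticeOf W₀ W' D₀.isNeronLattice
    P.isNeronLattice hc hle
  refine ⟨ψ, ?_⟩
  rw [hdeg, hψ, ← natCard_ker_mulQuotientMap_eq_relIndex (hc := hle)]
  congr 1
  have h₀' : ∀ z, z ∈ D₀.L.lattice.toAddSubgroup ↔ ∃ w ∈ periodLattice P.f, z = (D₀.c : ℂ) * w := by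
    intro z
    rw [Submodule.mem_toAddSubgroup, hf]
    exact ⟨h₀ z, by rintro ⟨w, hw, rfl⟩; exact D₀.smul_periodLattice_le w hw⟩
  exact natCard_ker_mulQuotientMap_rescale D₀.cast_c_ne_zero h₀'
    (by rw [hcast]; exact div_mul_cancel₀ _ D₀.cast_c_ne_zero)

/-! ## T1 — transport of a parametrisation datum along a `ℚ`-isogeny (NEW, PROVED) -/

/-- **T1 (datum transport).** If `W` carries a modular parametrisation datum `D` at level `N` and
`W ~ W'` over `ℚ`, then `W'` carries a datum at level `N` with the same newform.  The newform of
`W` is the newform of `W'` (`IsNewformOf.of_isIsogenous`), a Néron period pair `L'` of `W'` exists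
(`exists_isNeronLatticeOf_holds`), the Néron lattices of isogenous curves are commensurable,
`a Λ_W ⊆ Λ_{W'}` with `a ∈ ℤ ∖ {0}` (`neronLattice_commensurable_of_isIsogenous_holds`), so
`(a c) Λ_f ⊆ Λ_{W'}`, and a datum is exactly such a triple (`ModularParametrizationData.exists_of_isNewformOf`).
[cite: SilvermanAEC2009, Thm. VI.4.1(b)] [cite: Knapp1993, Thm. 11.67] -/
theorem exists_datum_of_isIsogenous {N : ℕ} [NeZero N] {W W' : WeierstrassCurve ℚ}
    [W.IsElliptic] [W'.IsElliptic] (D : ModularParametrizationData W N)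
    (hiso : W.IsIsogenous W') : ∃ D' : ModularParametrizationData W' N, D'.f = D.f := by
  have hf' : IsNewformOf W' D.f := D.isNewformOf.of_isIsogenous hiso.symm_of_charZero
  haveI : (W'.baseChange ℂ).IsElliptic := by rw [WeierstrassCurve.baseChange]; infer_instance
  obtain ⟨L', hL'⟩ := exists_isNeronLatticeOf_holds (W'.baseChange ℂ)
  obtain ⟨a, ha, hle⟩ :=
    neronLattice_commensurable_of_isIsogenous_holds hiso D.isNeronLattice hL'
  have hc : a * D.c ≠ 0 := mul_ne_zero ha D.maninConstant_ne_zero_holds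
  have hle' : ∀ z ∈ periodLattice D.f, ((a * D.c : ℤ) : ℂ) * z ∈ L'.lattice := by
    intro z hz
    rw [Int.cast_mul, mul_assoc]
    exact hle _ (D.smul_periodLattice_le z hz)
  obtain ⟨D', hD'f, -, -⟩ := ModularParametrizationData.exists_of_isNewformOf hf' hL' hc hle'
  exact ⟨D', hD'f⟩

/-! ## T2 — the isogeny radius from the optimal curve is `≤ 163`, from the fact (NEW, PROVED) -/

/-- **T2 (radius from the optimal curve).** For the lattice-optimal datum `(W₀, D₀)` and a
GLOBALLY MINIMAL `W' ~ W₀`, there is a `ℚ`-isogeny `W₀ → W'` of degree `≤ 163`:  T1 gives a datum of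
`W'`, a minimal one `D₁` (`exists_minimal_datum`) has `D₁.f = D₀.f` (`IsNewformOf.unique`), the fact
gives `deg D₁ ≤ 163 · deg D₀` (`D₀` is minimal among all data with its newform,
`modularDegree_le_of_isogenyMap_ker_eq_bot`), and H1 gives `ψ` with `deg ψ · deg D₀ = deg D₁`.
This is Pasten's "deg φ_{E'} ≤ 163 δ" read backwards; NO Mazur–Kenku is used — the `163` is the one
inside the fact. [cite: PastenShimura2024, §3 p. 13] -/
theorem exists_isogeny_degree_le_163 (h163 : PastenShimura2024_minimalDegree_le_163_mul)
    {N : ℕ} [NeZero N] {W₀ W' : WeierstrassCurve ℚ} [W₀.IsElliptic] [W'.IsElliptic]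
    [W'.IsGloballyMinimal] (D₀ : ModularParametrizationData W₀ N)
    (h₀ : ∀ z ∈ D₀.L.lattice, ∃ w ∈ periodLattice D₀.f, z = D₀.c * w)
    (hiso : W₀.IsIsogenous W') : ∃ ψ : Isogeny W₀ W', ψ.degree ≤ 163 := by
  obtain ⟨D', hD'f⟩ := exists_datum_of_isIsogenous D₀ hiso
  obtain ⟨D₁, -, hD₁min⟩ := exists_minimal_datum ⟨D'⟩
  have hf' : IsNewformOf W' D₀.f := hD'f ▸ D'.isNewformOf
  have hf₁ : D₁.f = D₀.f := D₁.isNewformOf.unique hf'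
  have hker₀ : D₀.isogenyMap.ker = ⊥ := D₀.isogenyMap_ker_eq_bot_iff.mpr h₀
  have hmin₀ : ∀ (W'' : WeierstrassCurve ℚ) [W''.IsElliptic]
      (D'' : ModularParametrizationData W'' N), D''.f = D₀.f →
        D₀.modularDegree ≤ D''.modularDegree := fun W'' _ D'' hD'' =>
    D₀.modularDegree_le_of_isogenyMap_ker_eq_bot hker₀ D'' hD''
  have h163' : D₁.modularDegree ≤ 163 * D₀.modularDegree := h163 N W₀ W' D₀ D₁ hf₁ hmin₀ hD₁min
  obtain ⟨ψ, hψ⟩ := exists_isogeny_degree_mul_modularDegree_eq D₀ D₁ h₀ hf₁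
  have hd₀ : 0 < D₀.modularDegree := D₀.deg_pos
  exact ⟨ψ, Nat.le_of_mul_le_mul_right (by rw [hψ]; exact h163') hd₀⟩

/-! ## L68² — Lemma 6.8 with constant `163²` for modular classes, from the fact (NEW, PROVED) -/

/-- **L68² (Pasten's Lemma 6.8 up to squaring the constant, Mazur–Kenku-free).**  Let `V/ℚ` carry a
modular parametrisation datum at some level `N`, let `W ~ V ~ W'` over `ℚ`, and let `v` be a place
of multiplicative reduction of `W`.  Then `c_v(W) · n = c_v(W') · m` for some `1 ≤ m, n ≤ 163²`
(`c_v = ord_v Δ_min`).  Proof: global minimal models `C • W`, `C' • W'` (`hasGlobalMinimalModel_rat_holds`;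
`c_v` is model-independent, `ordMinimalDiscriminant_smul_holds`); isogenies `ψ : W₀ → C • W`,
`ψ' : W₀ → C' • W'` of degree `≤ 163` from the optimal curve (T2); their cyclic parts
(`Isogeny.exists_isCyclic_degree_dvd`) give `c_v(W₀) b = c_v(W) a`, `c_v(W₀) b' = c_v(W') a'` with
`ab, a'b' ≤ 163` (`exists_ordMinimalDiscriminant_mul_eq_mul_of_isCyclic`, Tate curve); multiply.
Compare `PastenShimura2024_lemma_6_8` (constant `163`, no datum hypothesis, proof via Mazur–Kenku).
[cite: PastenShimura2024, Lemma 6.8 (p. 22) and §3 p. 13] -/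
theorem lemma_6_8_sq_of_pasten163 (h163 : PastenShimura2024_minimalDegree_le_163_mul)
    {N : ℕ} [NeZero N] {V : WeierstrassCurve ℚ} [V.IsElliptic]
    (DV : ModularParametrizationData V N) (W W' : WeierstrassCurve ℚ) [W.IsElliptic]
    [W'.IsElliptic] (hW : V.IsIsogenous W) (hW' : V.IsIsogenous W') (v : HeightOneSpectrum ℤ)
    (hv : W.HasMultiplicativeReductionAt v) :
    ∃ m n : ℕ, 0 < m ∧ m ≤ 163 * 163 ∧ 0 < n ∧ n ≤ 163 * 163 ∧
      W.ordMinimalDiscriminant v * n = W'.ordMinimalDiscriminant v * m := by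
  -- the lattice-optimal curve `W₀` of the class, with an isogeny `W₀ → V`
  obtain ⟨W₀, hW₀, D₀, hf₀, h₀⟩ := DV.exists_optimalDatum'
  haveI := hW₀
  obtain ⟨ψV, -⟩ := exists_isogeny_degree_mul_modularDegree_eq D₀ DV h₀ hf₀.symm
  -- every curve of the class: a global minimal model at isogeny distance `≤ 163` from `W₀`
  have key : ∀ (U : WeierstrassCurve ℚ) [U.IsElliptic], V.IsIsogenous U →
      ∃ (C : VariableChange ℚ) (ψ : Isogeny W₀ (C • U)), ψ.degree ≤ 163 := by
    intro U _ hU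
    obtain ⟨C, hC⟩ := hasGlobalMinimalModel_rat_holds U
    haveI := hC
    have h : W₀.IsIsogenous (C • U) :=
      (IsIsogenous.trans' ⟨ψV⟩ hU).trans' (isIsogenous_smul U C)
    obtain ⟨ψ, hψ⟩ := exists_isogeny_degree_le_163 h163 D₀ h₀ h
    exact ⟨C, ψ, hψ⟩
  obtain ⟨C, ψ, hψ⟩ := key W hW
  obtain ⟨C', ψ', hψ'⟩ := key W' hW'
  -- multiplicative reduction propagates through the class
  have hvC : (C • W).HasMultiplicativeReductionAt v :=
    hasMultiplicativeReductionAt_of_isIsogenous (isIsogenous_smul W C) v hv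
  have hv₀ : W₀.HasMultiplicativeReductionAt v :=
    hasMultiplicativeReductionAt_of_isIsogenous (IsIsogenous.symm_of_charZero ⟨ψ⟩) v hvC
  have hvC' : (C' • W').HasMultiplicativeReductionAt v :=
    hasMultiplicativeReductionAt_of_isIsogenous ⟨ψ'⟩ v hv₀
  -- the exact cyclic transport lemma, twice
  obtain ⟨ψc, hcyc, hdvd⟩ := ψ.exists_isCyclic_degree_dvd
  obtain ⟨a, b, ha, hb, hab, heq⟩ :=
    exists_ordMinimalDiscriminant_mul_eq_mul_of_isCyclic ψc.degree ψc hcyc rfl v hv₀ hvC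
  obtain ⟨ψc', hcyc', hdvd'⟩ := ψ'.exists_isCyclic_degree_dvd
  obtain ⟨a', b', ha', hb', hab', heq'⟩ :=
    exists_ordMinimalDiscriminant_mul_eq_mul_of_isCyclic ψc'.degree ψc' hcyc' rfl v hv₀ hvC'
  -- `heq : c_v(W₀) b = c_v(C • W) a`, `heq' : c_v(W₀) b' = c_v(C' • W') a'`
  rw [ordMinimalDiscriminant_smul_holds v W C] at heq
  rw [ordMinimalDiscriminant_smul_holds v W' C'] at heq'
  have h1 : a * b ≤ 163 :=
    (Nat.le_of_dvd ψc.degree_pos hab).trans ((Nat.le_of_dvd ψ.degree_pos hdvd).trans hψ)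
  have h2 : a' * b' ≤ 163 :=
    (Nat.le_of_dvd ψc'.degree_pos hab').trans ((Nat.le_of_dvd ψ'.degree_pos hdvd').trans hψ')
  have ha1 : a ≤ 163 := (Nat.le_mul_of_pos_right a hb).trans h1
  have hb1 : b ≤ 163 := (Nat.le_mul_of_pos_left b ha).trans h1
  have ha2 : a' ≤ 163 := (Nat.le_mul_of_pos_right a' hb').trans h2
  have hb2 : b' ≤ 163 := (Nat.le_mul_of_pos_left b' ha').trans h2
  refine ⟨a' * b, a * b', Nat.mul_pos ha' hb, Nat.mul_le_mul ha2 hb1, Nat.mul_pos ha hb',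
    Nat.mul_le_mul ha1 hb2, ?_⟩
  calc W.ordMinimalDiscriminant v * (a * b')
      = W.ordMinimalDiscriminant v * a * b' := by ring
    _ = W₀.ordMinimalDiscriminant v * b * b' := by rw [← heq]
    _ = W₀.ordMinimalDiscriminant v * b' * b := by ring
    _ = W'.ordMinimalDiscriminant v * a' * b := by rw [heq']
    _ = W'.ordMinimalDiscriminant v * (a' * b) := by ring

/-- **L68² in inequality form** (the shape the consumers use): `c_v(W') ≤ 163² · c_v(W)` and
`c_v(W) ≤ 163² · c_v(W')` for `W ~ V ~ W'`, `V` modular, `W` multiplicative at `v`. [folklore] -/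
theorem ordMinimalDiscriminant_le_sq_mul_of_pasten163
    (h163 : PastenShimura2024_minimalDegree_le_163_mul)
    {N : ℕ} [NeZero N] {V : WeierstrassCurve ℚ} [V.IsElliptic]
    (DV : ModularParametrizationData V N) (W W' : WeierstrassCurve ℚ) [W.IsElliptic]
    [W'.IsElliptic] (hW : V.IsIsogenous W) (hW' : V.IsIsogenous W') (v : HeightOneSpectrum ℤ)
    (hv : W.HasMultiplicativeReductionAt v) :
    W'.ordMinimalDiscriminant v ≤ 163 * 163 * W.ordMinimalDiscriminant v ∧
      W.ordMinimalDiscriminant v ≤ 163 * 163 * W'.ordMinimalDiscriminant v := by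
  obtain ⟨m, n, hm, hm1, hn, hn1, hmn⟩ := lemma_6_8_sq_of_pasten163 h163 DV W W' hW hW' v hv
  constructor
  · calc W'.ordMinimalDiscriminant v
        ≤ W'.ordMinimalDiscriminant v * m := Nat.le_mul_of_pos_right _ hm
      _ = W.ordMinimalDiscriminant v * n := hmn.symm
      _ ≤ W.ordMinimalDiscriminant v * (163 * 163) := Nat.mul_le_mul_left _ hn1
      _ = 163 * 163 * W.ordMinimalDiscriminant v := Nat.mul_comm _ _
  · calc W.ordMinimalDiscriminant v
        ≤ W.ordMinimalDiscriminant v * n := Nat.le_mul_of_pos_right _ hn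
      _ = W'.ordMinimalDiscriminant v * m := hmn
      _ ≤ W'.ordMinimalDiscriminant v * (163 * 163) := Nat.mul_le_mul_left _ hm1
      _ = 163 * 163 * W'.ordMinimalDiscriminant v := Nat.mul_comm _ _

/-! ## VT² — the drop-in for `stub_valTransport h68 …` with `163²`, from the fact + a datum (NEW, PROVED) -/

/-- **VT² (valuation transport from a Frey curve, `163²`, no Lemma 6.8).**  Same binders as the landed
`Theorems.DefiniteRTControlPrime.stub_valTransport` after its first one, with
`h68 : PastenShimura2024_lemma_6_8` replaced by `h163 : PastenShimura2024_minimalDegree_le_163_mul`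
plus a datum `DV` of some curve `V ~ E` of the class (at every call site one is in scope:
`D`, `D₀`, `D₁`, `P`, `Ps`): for coprime `a, b`, `ab(a+b) ≠ 0`, an odd prime `q ∣ N(E)` and `W' ~ E`,
`v_q(Δ_min W') ≤ 163² · v_q(Δ_min E)`. [cite: PastenShimura2024, Lemma 6.8 (p. 22)] -/
theorem valTransportSq_of_pasten163 (h163 : PastenShimura2024_minimalDegree_le_163_mul)
    {N : ℕ} [NeZero N] {V : WeierstrassCurve ℚ} [V.IsElliptic]
    (DV : ModularParametrizationData V N) (a b : ℤ) (hab : IsCoprime a b)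
    (h0 : a * b * (a + b) ≠ 0) (hV : (freyCurve a b).IsIsogenous V) (q : ℕ) (hq : q.Prime)
    (hq2 : q ≠ 2) (hqN : q ∣ (freyCurve a b).conductorNorm ℤ)
    (W' : WeierstrassCurve ℚ) [W'.IsElliptic] (hiso : (freyCurve a b).IsIsogenous W') :
    (W'.minimalDiscriminantNorm ℤ).factorization q ≤
      163 * 163 * ((freyCurve a b).minimalDiscriminantNorm ℤ).factorization q := by
  haveI := isElliptic_freyCurve h0
  obtain ⟨v, hv⟩ :
      ∃ v : HeightOneSpectrum ℤ, Rat.HeightOneSpectrum.natGenerator v = q :=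
    ⟨(Rat.HeightOneSpectrum.primesEquiv (R := ℤ)).symm ⟨q, hq⟩,
      Rat.natGenerator_primesEquiv_symm ⟨q, hq⟩⟩
  have hdvd : (q : ℤ) ∣ a * b * (a + b) :=
    Literature.NumberTheory.DiophantineGeometry.dvd_of_dvd_conductorNorm_freyCurve hab h0 hq hq2 hqN
  have hmult : (freyCurve a b).HasMultiplicativeReductionAt v :=
    Literature.NumberTheory.DiophantineGeometry.hasMultiplicativeReductionAt_freyCurve_of_ne_two
      hab h0 v (hv ▸ hq2) (hv ▸ hdvd)
  have hVE : V.IsIsogenous (freyCurve a b) := hV.symm_of_charZero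
  obtain ⟨h1, -⟩ := ordMinimalDiscriminant_le_sq_mul_of_pasten163 h163 DV (freyCurve a b) W'
    hVE (hVE.trans' hiso) v hmult
  have e1 := factorization_minimalDiscriminantNorm_holds W' v
  have e2 := factorization_minimalDiscriminantNorm_holds (freyCurve a b) v
  rw [hv] at e1 e2
  rw [e1, e2]
  exact h1

/-- **VT², datum of the Frey curve itself** (the shape at `DefiniteRTControlPrime`'s binder `D`).
[cite: PastenShimura2024, Lemma 6.8 (p. 22)] -/
theorem valTransportSq_of_pasten163_self (h163 : PastenShimura2024_minimalDegree_le_163_mul)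
    (a b : ℤ) (hab : IsCoprime a b) (h0 : a * b * (a + b) ≠ 0) {N : ℕ} [NeZero N]
    (D : ModularParametrizationData (freyCurve a b) N) (q : ℕ) (hq : q.Prime) (hq2 : q ≠ 2)
    (hqN : q ∣ (freyCurve a b).conductorNorm ℤ) (W' : WeierstrassCurve ℚ) [W'.IsElliptic]
    (hiso : (freyCurve a b).IsIsogenous W') :
    (W'.minimalDiscriminantNorm ℤ).factorization q ≤
      163 * 163 * ((freyCurve a b).minimalDiscriminantNorm ℤ).factorization q := by
  haveI := isElliptic_freyCurve h0
  exact valTransportSq_of_pasten163 h163 D a b hab h0 (isIsogenous_self (freyCurve a b)) q hq hq2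
    hqN W' hiso

/-! ## What the verbatim stub would add (status, no new content): `163` instead of `163²` needs a
DIRECT cyclic isogeny `W → W'` of degree `≤ 163` for arbitrary `W ~ W'`, i.e. the Mazur–Kenku radius
(route items stmt-ABC-15193 / 18223 / 18224); the tree already derives the verbatim fact from them
(`PastenShimura2024_lemma_6_8_of_mazurKenku'`).  Two-step transport through `W₀` cannot do better
than `163²` in general (e.g. `W, W'` at opposite ends of a cyclic `N`-isogeny chain through `W₀`). -/

end Summit.ABC.ABC.Cruxes.DefiniteRTControlPrime.StubIdeas3G5

end
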